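import Summits.RiemannHypothesis.RiemannHypothesis.Theorems.SoloInformedKunnethTower

/-!
# The squeeze lives on the diagonal, I: off-diagonal Künneth towers are the total off-line excess (solo-informed, T55a)

`SoloInformedKunnethTower` (T54) typed the second un-excluded proof shape of the solo-informed
census — Deligne's tensor-power squeeze transposed to `ζ` — as `KunnethLevel k C` ("a carrier
confined to `Re ≤ k/2 + C` contains every sum `ρ₁ + ⋯ + ρ_k` of non-trivial zeros") and proved
`RiemannHypothesis ↔ ∃ C, ∀ k ≥ 1, KunnethLevel k C`, each level being the closed quasi-Riemann
hypothesis at `1/2 + C/k` via the DIAGONAL tuple `(ρ, …, ρ)`.  This file asks how much of that is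
carried by the diagonal, over an ARBITRARY "zero set" `N ⊆ ℂ` (critical line `Re = 1/2`); the
specialisation to `ζ` is `SoloInformedOfflineExcess` (T55b).

`DistinctKunnethLevelOn N k C` is the Künneth axiom restricted to PAIRWISE-DISTINCT `k`-tuples —
the honest exterior product of `k` distinct eigenclasses, the diagonal embedding removed.  Results:

* `distinctKunnethLevelOn_iff` (carrier elimination): level `k` says `∑_{ρ ∈ S} Re ρ ≤ k/2 + C` for
  every `k`-element `S ⊆ N`; hence (`distinctKunnethTowerOn_iff_excessLeOn`) the whole off-diagonal
  tower with ONE constant `C` is exactly `ExcessLeOn N C`, the TOTAL OFF-LINE EXCESS bound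
  `∑_{ρ ∈ S} (Re ρ - 1/2) ≤ C` over all finite `S ⊆ N`.
* What finite excess is worth: `Re ρ ≤ 1/2 + C` (singletons), `Re ρ ≤ 1/2 + C/2` for a point sharing
  its real part with another point of `N` (pairs — for `ζ`, `conj ρ`), and for every `σ > 1/2` the set
  `N ∩ {Re ≥ σ}` is FINITE with at most `C/(σ - 1/2)` elements (`ExcessLeOn.finite_re_ge`,
  `ExcessLeOn.ncard_re_ge_le`): "`N(σ, T) = O(1/(σ - 1/2))` uniformly in `T`".
* SEPARATION (`exists_distinctTower_not_kunnethTower`): the off-line quartet `{1/2 ± c ± i}` — closed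
  under `conj` and `z ↦ 1 - conj z`, inside the open strip — satisfies every off-diagonal level with
  the constant `2c` and violates the full tower for every constant.  So no off-diagonal Künneth axiom
  with `k`-independent loss excludes a single off-line quartet: the step "bounded excess ⟹ zero
  excess", which is all of RH beyond finiteness, is carried by the diagonal `ρ ↦ (ρ, …, ρ)` ALONE,
  i.e. by the POWER operation `ρ ↦ kρ` (Frobenius `α ↦ α^k` on one eigenclass — an Adams /
  symmetric-power operation) with a loss uniform in `k`.  For a curve (`b₁ < ∞`) finite excess is
  empty of content, so Deligne's squeeze was always a statement about powers of one eigenvalue in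
  `X^k` over the same base; base change `𝔽_q → 𝔽_{q^k}` also realises `α ↦ α^k` but with loss `∝ k`
  (`ζ(s) ↦ ζ(s/k)`: T54 `kunnethLevel_half_mul`).  Reading continued in T55b.

Honest grade: elementary (finite sums, Archimedes, one four-point model); new as the kernel
statement separating the off-diagonal content (finite excess) from the RH-content (the diagonal).
-/
noncomputable section

open Complex Set Finset Literature.NumberTheory.LFunctions
open Literature.NumberTheory.LFunctions.ZetaZeros
open scoped ComplexConjugate

namespace Summit.RiemannHypothesis.RiemannHypothesis.Theorems

variable {N N' : Set ℂ} {k : ℕ} {C C' σ : ℝ} {ρ ρ' : ℂ}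

/-! ## Künneth levels over an arbitrary zero set -/

/-- Level `k` of a Künneth tower with Euler barrier `C` over an arbitrary "zero set" `N ⊆ ℂ`
(critical line `Re = 1/2`): a carrier `Z` confined to `Re z ≤ k/2 + C` containing every sum of a
`k`-tuple from `N`.  `KunnethLevel k C` of T54 is the case `N =` non-trivial zeros of `ζ`
(`kunnethLevel_iff_kunnethLevelOn`, by `rfl`). [folklore] -/
def KunnethLevelOn (N : Set ℂ) (k : ℕ) (C : ℝ) : Prop :=
  ∃ Z : Set ℂ, (∀ z ∈ Z, z.re ≤ k / 2 + C) ∧ ∀ ρ : Fin k → ℂ, (∀ i, ρ i ∈ N) → ∑ i, ρ i ∈ Z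

/-- **Off-diagonal Künneth level**: the same axiom pair, but the Künneth containment is required
only for PAIRWISE-DISTINCT tuples `ρ : Fin k → N` (`Function.Injective ρ`) — the exterior product
of `k` distinct eigenclasses, the diagonal embedding `ρ ↦ (ρ, …, ρ)` removed. [folklore] -/
def DistinctKunnethLevelOn (N : Set ℂ) (k : ℕ) (C : ℝ) : Prop :=
  ∃ Z : Set ℂ, (∀ z ∈ Z, z.re ≤ k / 2 + C) ∧
    ∀ ρ : Fin k → ℂ, Function.Injective ρ → (∀ i, ρ i ∈ N) → ∑ i, ρ i ∈ Z

/-- **Total off-line excess at most `C`** (finitary form, no summability posited): every finite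
`S ⊆ N` has `∑_{ρ ∈ S} (Re ρ - 1/2) ≤ C`.  Points left of the line contribute negatively, so this
is the statement that the positive parts `(Re ρ - 1/2)⁺` have total sum `≤ C`. [folklore] -/
def ExcessLeOn (N : Set ℂ) (C : ℝ) : Prop :=
  ∀ S : Finset ℂ, (↑S : Set ℂ) ⊆ N → ∑ ρ ∈ S, (ρ.re - 1 / 2) ≤ C

/-- T54's `KunnethLevel` is `KunnethLevelOn` the non-trivial zeros, definitionally. [folklore] -/
theorem kunnethLevel_iff_kunnethLevelOn :
    KunnethLevel k C ↔ KunnethLevelOn riemannZetaNontrivialZeros k C := Iff.rfl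

/-- Carrier elimination for full levels over any `N` (the diagonal tuple; T54 `kunnethLevel_iff`
verbatim): level `k ≥ 1` with barrier `C` says `Re ρ ≤ 1/2 + C/k` on `N`. [folklore] -/
theorem kunnethLevelOn_iff (hk : 1 ≤ k) :
    KunnethLevelOn N k C ↔ ∀ ρ ∈ N, ρ.re ≤ 1 / 2 + C / k := by
  have hk0 : (0 : ℝ) < k := by exact_mod_cast hk
  constructor
  · rintro ⟨Z, hZ, hK⟩ ρ hρ
    have hmem := hK (fun _ : Fin k ↦ ρ) fun _ ↦ hρ
    have hre := hZ _ hmem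
    rw [Finset.sum_const, Finset.card_univ, Fintype.card_fin, re_nsmul, nsmul_eq_mul] at hre
    rw [← mul_le_mul_iff_of_pos_left hk0]
    have : (k : ℝ) * (1 / 2 + C / k) = k / 2 + C := by field_simp
    linarith
  · intro h
    refine ⟨{z | z.re ≤ k / 2 + C}, fun z hz ↦ hz, fun ρ hρ ↦ ?_⟩
    show (∑ i, ρ i).re ≤ k / 2 + C
    rw [re_sum]
    calc ∑ i, (ρ i).re ≤ ∑ _i : Fin k, (1 / 2 + C / k) := Finset.sum_le_sum fun i _ ↦ h _ (hρ i)
      _ = k / 2 + C := by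
        rw [Finset.sum_const, Finset.card_univ, Fintype.card_fin, nsmul_eq_mul]; field_simp

/-- A full level implies the off-diagonal level (same carrier). [folklore] -/
theorem KunnethLevelOn.distinct (h : KunnethLevelOn N k C) : DistinctKunnethLevelOn N k C := by
  obtain ⟨Z, hZ, hK⟩ := h
  exact ⟨Z, hZ, fun ρ _ hρ ↦ hK ρ hρ⟩

/-- **Carrier elimination for off-diagonal levels.**  Level `k` with barrier `C` says exactly:
every `k`-element subset `S ⊆ N` has `∑_{ρ ∈ S} Re ρ ≤ k/2 + C` ((⟹) enumerate `S` by `Fin k`;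
(⟸) the half-plane carrier and the image finset of an injective tuple). [folklore] -/
theorem distinctKunnethLevelOn_iff :
    DistinctKunnethLevelOn N k C ↔
      ∀ S : Finset ℂ, (↑S : Set ℂ) ⊆ N → S.card = k → ∑ ρ ∈ S, ρ.re ≤ k / 2 + C := by
  classical
  constructor
  · rintro ⟨Z, hZ, hK⟩ S hS hcard
    let e : Fin k ≃ ↥S := (S.equivFin.trans (finCongr hcard)).symm
    have hinj : Function.Injective (fun i ↦ ((e i : ↥S) : ℂ)) :=
      Subtype.val_injective.comp e.injective
    have hmemN : ∀ i, ((e i : ↥S) : ℂ) ∈ N := fun i ↦ hS (e i).2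
    have hre := hZ _ (hK _ hinj hmemN)
    have hsum : ∑ i, ((e i : ↥S) : ℂ) = ∑ ρ ∈ S, ρ := by
      rw [Fintype.sum_equiv e (fun i ↦ ((e i : ↥S) : ℂ)) (fun x ↦ (x : ℂ)) (fun _ ↦ rfl)]
      exact Finset.sum_coe_sort S (fun x ↦ x)
    rw [hsum, re_sum] at hre
    exact hre
  · intro h
    refine ⟨{z | z.re ≤ k / 2 + C}, fun z hz ↦ hz, fun ρ hinj hρ ↦ ?_⟩
    show (∑ i, ρ i).re ≤ k / 2 + C
    have hcard : (Finset.univ.image ρ).card = k := by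
      rw [Finset.card_image_of_injective _ hinj, Finset.card_univ, Fintype.card_fin]
    have hsub : (↑(Finset.univ.image ρ) : Set ℂ) ⊆ N := by
      intro z hz
      rw [Finset.coe_image] at hz
      obtain ⟨i, -, rfl⟩ := hz
      exact hρ i
    have h' := h _ hsub hcard
    rw [Finset.sum_image (fun x _ y _ hxy ↦ hinj hxy)] at h'
    rwa [re_sum]

/-- **The off-diagonal tower is the total excess.**  For any `N` and any constant `C`:
all off-diagonal levels `k = 0, 1, 2, …` hold with barrier `C` iff `ExcessLeOn N C`
(`∑_{S} Re ρ ≤ |S|/2 + C` for every finite `S ⊆ N`). [folklore] -/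
theorem distinctKunnethTowerOn_iff_excessLeOn :
    (∀ k : ℕ, DistinctKunnethLevelOn N k C) ↔ ExcessLeOn N C := by
  simp only [distinctKunnethLevelOn_iff]
  constructor
  · intro h S hS
    have h1 := h S.card S hS rfl
    have hsub : ∑ ρ ∈ S, (ρ.re - 1 / 2) = ∑ ρ ∈ S, ρ.re - S.card / 2 := by
      rw [Finset.sum_sub_distrib, Finset.sum_const, nsmul_eq_mul]; ring
    linarith
  · intro h k S hS hcard
    have h1 := h S hS
    have hsub : ∑ ρ ∈ S, (ρ.re - 1 / 2) = ∑ ρ ∈ S, ρ.re - S.card / 2 := by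
      rw [Finset.sum_sub_distrib, Finset.sum_const, nsmul_eq_mul]; ring
    rw [hcard] at hsub
    linarith

/-! ## What finite total excess is worth -/

/-- The excess bound is non-negative (empty set). [folklore] -/
theorem ExcessLeOn.nonneg (h : ExcessLeOn N C) : 0 ≤ C := by
  simpa using h ∅ (by simp)

/-- Monotone in the bound. [folklore] -/
theorem ExcessLeOn.mono (h : ExcessLeOn N C) (hC : C ≤ C') : ExcessLeOn N C' :=
  fun S hS ↦ (h S hS).trans hC

/-- Antitone in the set. [folklore] -/
theorem ExcessLeOn.anti (h : ExcessLeOn N C) (hN : N' ⊆ N) : ExcessLeOn N' C :=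
  fun S hS ↦ h S (hS.trans hN)

/-- Singletons: finite excess `C` confines `N` to `Re ≤ 1/2 + C` (level `1`). [folklore] -/
theorem ExcessLeOn.re_le (h : ExcessLeOn N C) (hρ : ρ ∈ N) : ρ.re ≤ 1 / 2 + C := by
  have h1 := h {ρ} (by simpa using hρ)
  rw [Finset.sum_singleton] at h1
  linarith

/-- Pairs: a point of `N` sharing its real part with a DIFFERENT point of `N` has
`Re ρ ≤ 1/2 + C/2` — the rung of the square.  For zero sets closed under conjugation and off the
real axis this applies to every point (`OfflineExcessLe.re_le`). [folklore] -/
theorem ExcessLeOn.re_le_of_pair (h : ExcessLeOn N C) (hρ : ρ ∈ N) (hρ' : ρ' ∈ N) (hne : ρ ≠ ρ')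
    (hre : ρ'.re = ρ.re) : ρ.re ≤ 1 / 2 + C / 2 := by
  have hS : (↑({ρ, ρ'} : Finset ℂ) : Set ℂ) ⊆ N := by
    intro z hz
    simp only [Finset.coe_insert, Finset.coe_singleton, Set.mem_insert_iff,
      Set.mem_singleton_iff] at hz
    rcases hz with rfl | rfl
    · exact hρ
    · exact hρ'
  have h1 := h {ρ, ρ'} hS
  rw [Finset.sum_pair hne, hre] at h1
  linarith

/-- Counting: a finite set of points of `N` right of `σ > 1/2` has at most `C/(σ - 1/2)`
elements. [folklore] -/
theorem ExcessLeOn.card_le (h : ExcessLeOn N C) (hσ : 1 / 2 < σ) {T : Finset ℂ}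
    (hT : (↑T : Set ℂ) ⊆ N ∩ {z | σ ≤ z.re}) : (T.card : ℝ) ≤ C / (σ - 1 / 2) := by
  rw [le_div_iff₀ (by linarith)]
  have h1 := h T (hT.trans Set.inter_subset_left)
  have h2 : ∑ _ρ ∈ T, (σ - 1 / 2) ≤ ∑ ρ ∈ T, (ρ.re - 1 / 2) :=
    Finset.sum_le_sum fun ρ hρ ↦ by
      have hmem := (hT (Finset.mem_coe.2 hρ)).2
      simp only [Set.mem_setOf_eq] at hmem
      linarith
  rw [Finset.sum_const, nsmul_eq_mul] at h2
  linarith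

/-- **Finite excess ⟹ finitely many points right of every `σ > 1/2`.**  In zero-counting terms:
`N(σ, T) = O(1/(σ - 1/2))` uniformly in `T` — far beyond every density theorem (census F2), yet
(by `exists_distinctTower_not_kunnethTower`) not RH. [folklore] -/
theorem ExcessLeOn.finite_re_ge (h : ExcessLeOn N C) (hσ : 1 / 2 < σ) :
    (N ∩ {z | σ ≤ z.re}).Finite := by
  by_contra hinf
  obtain ⟨T, hT, hcard⟩ := Set.Infinite.exists_subset_card_eq hinf (⌊C / (σ - 1 / 2)⌋₊ + 1)
  have h1 := h.card_le hσ hT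
  rw [hcard] at h1
  have h2 := Nat.lt_floor_add_one (C / (σ - 1 / 2))
  push_cast at h1
  linarith

/-- The explicit count: `#(N ∩ {Re ≥ σ}) ≤ C/(σ - 1/2)`. [folklore] -/
theorem ExcessLeOn.ncard_re_ge_le (h : ExcessLeOn N C) (hσ : 1 / 2 < σ) :
    ((N ∩ {z | σ ≤ z.re}).ncard : ℝ) ≤ C / (σ - 1 / 2) := by
  obtain ⟨T, hT⟩ := (h.finite_re_ge hσ).exists_finset_coe
  rw [← hT, Set.ncard_coe_finset]
  exact h.card_le hσ hT.le

/-- The full tower with ANY constant confines `N` to the closed left half `Re ≤ 1/2`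
(Archimedes on the diagonal; T54 `riemannHypothesis_of_kunnethTower` abstracted). [folklore] -/
theorem re_le_half_of_kunnethTowerOn (h : ∀ k : ℕ, 1 ≤ k → KunnethLevelOn N k C) (hρ : ρ ∈ N) :
    ρ.re ≤ 1 / 2 := by
  have : ρ.re - 1 / 2 ≤ 0 := by
    refine nonpos_of_forall_nat_mul_le (C := C) fun k hk ↦ ?_
    have hk0 : (0 : ℝ) < k := by exact_mod_cast hk
    have h1 := (kunnethLevelOn_iff hk).1 (h k hk) ρ hρ
    have hkk : (k : ℝ) * (C / k) = C := by field_simp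
    nlinarith
  linarith

/-! ## Separation: one off-line quartet -/

/-- The off-line quartet `{1/2 + c ± i, 1/2 - c ± i}`: the orbit of one hypothetical zero
`1/2 + c + i` under `z ↦ conj z` and `z ↦ 1 - conj z`. [folklore] -/
def offlineQuartet (c : ℝ) : Set ℂ :=
  {z | (z.re = 1 / 2 + c ∨ z.re = 1 / 2 - c) ∧ (z.im = 1 ∨ z.im = -1)}

/-- The off-line point belongs to its quartet. [folklore] -/
theorem mk_mem_offlineQuartet (c : ℝ) : (⟨1 / 2 + c, 1⟩ : ℂ) ∈ offlineQuartet c :=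
  ⟨Or.inl rfl, Or.inl rfl⟩

/-- The quartet is closed under complex conjugation. [folklore] -/
theorem conj_mem_offlineQuartet {c : ℝ} {z : ℂ} (hz : z ∈ offlineQuartet c) :
    conj z ∈ offlineQuartet c := by
  obtain ⟨h1, h2⟩ := hz
  refine ⟨by rwa [Complex.conj_re], ?_⟩
  rcases h2 with h | h
  · right; rw [Complex.conj_im, h]
  · left; rw [Complex.conj_im, h]; ring

/-- The quartet is closed under the functional-equation symmetry `z ↦ 1 - conj z`. [folklore] -/
theorem one_sub_conj_mem_offlineQuartet {c : ℝ} {z : ℂ} (hz : z ∈ offlineQuartet c) :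
    1 - conj z ∈ offlineQuartet c := by
  obtain ⟨h1, h2⟩ := hz
  constructor
  · rcases h1 with h | h
    · right; rw [Complex.sub_re, Complex.one_re, Complex.conj_re, h]; ring
    · left; rw [Complex.sub_re, Complex.one_re, Complex.conj_re, h]; ring
  · rcases h2 with h | h
    · left; rw [Complex.sub_im, Complex.one_im, Complex.conj_im, h]; ring
    · right; rw [Complex.sub_im, Complex.one_im, Complex.conj_im, h]; ring

/-- For `0 < c < 1/2` the quartet lies in the open critical strip. [folklore] -/
theorem re_mem_Ioo_of_mem_offlineQuartet {c : ℝ} (hc : 0 < c) (hc' : c < 1 / 2) {z : ℂ}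
    (hz : z ∈ offlineQuartet c) : 0 < z.re ∧ z.re < 1 := by
  rcases hz.1 with h | h <;> rw [h] <;> constructor <;> linarith

/-- **The quartet has total excess `2c`** (its two right-hand points contribute `c` each, the two
left-hand points `-c ≤ 0`). [folklore] -/
theorem excessLeOn_offlineQuartet {c : ℝ} (hc : 0 ≤ c) : ExcessLeOn (offlineQuartet c) (2 * c) := by
  classical
  intro S hS
  set P : ℂ → Prop := fun z ↦ z.re = 1 / 2 + c with hP
  rw [← Finset.sum_filter_add_sum_filter_not S P]
  have hA : ∑ ρ ∈ S.filter P, (ρ.re - 1 / 2) ≤ 2 * c := by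
    have hcard : (S.filter P).card ≤ 2 := by
      have hsub : S.filter P ⊆ {(⟨1 / 2 + c, 1⟩ : ℂ), ⟨1 / 2 + c, -1⟩} := by
        intro z hz
        rw [Finset.mem_filter] at hz
        obtain ⟨hzS, hzre⟩ := hz
        have hzim := (hS (Finset.mem_coe.2 hzS)).2
        rw [Finset.mem_insert, Finset.mem_singleton]
        rcases hzim with h | h
        · left; exact Complex.ext hzre h
        · right; exact Complex.ext hzre h
      exact (Finset.card_le_card hsub).trans Finset.card_le_two
    calc ∑ ρ ∈ S.filter P, (ρ.re - 1 / 2) = ∑ _ρ ∈ S.filter P, c :=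
          Finset.sum_congr rfl fun z hz ↦ by rw [(Finset.mem_filter.1 hz).2]; ring
      _ = (S.filter P).card * c := by rw [Finset.sum_const, nsmul_eq_mul]
      _ ≤ 2 * c := by
          have h2 : ((S.filter P).card : ℝ) ≤ 2 := by exact_mod_cast hcard
          nlinarith
  have hB : ∑ ρ ∈ S.filter (fun z ↦ ¬ P z), (ρ.re - 1 / 2) ≤ 0 := by
    refine Finset.sum_nonpos fun z hz ↦ ?_
    rw [Finset.mem_filter] at hz
    obtain ⟨hzS, hzP⟩ := hz
    rcases (hS (Finset.mem_coe.2 hzS)).1 with h | h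
    · exact absurd h hzP
    · rw [h]; linarith
  linarith

/-- Hence the quartet satisfies EVERY off-diagonal level with the `k`-independent barrier `2c`.
[folklore] -/
theorem distinctKunnethLevelOn_offlineQuartet {c : ℝ} (hc : 0 ≤ c) (k : ℕ) :
    DistinctKunnethLevelOn (offlineQuartet c) k (2 * c) :=
  (distinctKunnethTowerOn_iff_excessLeOn.2 (excessLeOn_offlineQuartet hc)) k

/-- … while it violates the full tower for every constant whatsoever. [folklore] -/
theorem not_kunnethTowerOn_offlineQuartet {c : ℝ} (hc : 0 < c) (C : ℝ) :
    ¬ ∀ k : ℕ, 1 ≤ k → KunnethLevelOn (offlineQuartet c) k C := fun h ↦ by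
  have h1 := re_le_half_of_kunnethTowerOn h (mk_mem_offlineQuartet c)
  change 1 / 2 + c ≤ 1 / 2 at h1
  linarith

/-- **Separation theorem.**  There is a zero set with all the symmetries of the non-trivial zeros
(conjugation, `z ↦ 1 - conj z`, open strip) on which the off-diagonal Künneth tower holds with ONE
constant for all `k` and the full tower fails for EVERY constant: the off-line quartet at offset
`1/4`.  So the implication "tower with `k`-uniform loss ⟹ critical line" is a property of the
diagonal tuples alone. [folklore] -/
theorem exists_distinctTower_not_kunnethTower :
    ∃ N : Set ℂ, (∀ z ∈ N, conj z ∈ N) ∧ (∀ z ∈ N, 1 - conj z ∈ N) ∧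
      (∀ z ∈ N, 0 < z.re ∧ z.re < 1) ∧ (∃ z ∈ N, 1 / 2 < z.re) ∧
      (∀ k : ℕ, DistinctKunnethLevelOn N k (1 / 2)) ∧
      ∀ C : ℝ, ¬ ∀ k : ℕ, 1 ≤ k → KunnethLevelOn N k C := by
  refine ⟨offlineQuartet (1 / 4), fun _ ↦ conj_mem_offlineQuartet,
    fun _ ↦ one_sub_conj_mem_offlineQuartet,
    fun _ hz ↦ re_mem_Ioo_of_mem_offlineQuartet (by norm_num) (by norm_num) hz,
    ⟨_, mk_mem_offlineQuartet (1 / 4), by change (1 : ℝ) / 2 < 1 / 2 + 1 / 4; norm_num⟩,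
    fun k ↦ ?_, not_kunnethTowerOn_offlineQuartet (by norm_num)⟩
  have h := distinctKunnethLevelOn_offlineQuartet (c := 1 / 4) (by norm_num) k
  norm_num at h
  exact h

end Summit.RiemannHypothesis.RiemannHypothesis.Theorems

end
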